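import Summits.HodgeConjecture.HodgeConjecture.Theorems.NoetherLefschetzOneUpSummitGrantedFourfoldsCohomologicallyAlgebraicTransfer
import Literature.AlgebraicGeometry.HodgeTheory.IsoTransport
import Literature.AlgebraicGeometry.HodgeTheory.HolomorphicBundleChernCharacterProjectiveSpace
import Literature.AlgebraicGeometry.HodgeTheory.FermatOddDegreeRestriction

/-!
# The transfer theorem on either side: `HC(Y) ⟹ HC(V × Y)` and `HC(Y × ℙᴺ)`, `HC(ℙᴺ × Y)`
# (helper for crux `SummitGrantedFourfolds`, stmt-HodgeConjecture-14600)

Route `HodgeConjecture/NoetherLefschetzOneUp`, crux `SummitGrantedFourfolds` (stmt-HodgeConjecture-14600).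
Companion of `…CohomologicallyAlgebraicTransfer` (`HC(Y) ⟹ HC(Y ⊗ V)` for `V` cohomologically
algebraic). This file adds:

* `hodgeClasses_algebraic_of_iso`, `hodgeConjectureFor_of_iso` — the (cycle part of the) Hodge
  conjecture in the summit's spelling is invariant under isomorphisms of smooth projective `ℂ`-schemes
  (pull-backs preserve rationality and Hodge types; `mem_algebraicClasses_map_iff_of_iso`);
* `hodgeConjectureFor_tensor_of_right` — the transfer theorem with the cohomologically algebraic factor
  FIRST, `HC(Y) ⟹ HC(V ⊗ Y)`, through the symmetry `V ⊗ Y ≅ Y ⊗ V` of the cartesian product;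
* `hodgeConjectureFor_tensor_projectiveSpace_of_hodgeConjectureFor`, `…_projectiveSpace_tensor_…` —
  **the Hodge conjecture is stable under `× ℙᴺ`**: `HC(Y) ⟹ HC(Y × ℙᴺ)` and `HC(ℙᴺ × Y)` for every
  smooth projective `Y` and every `N` (`ℙᴺ` is cohomologically algebraic:
  `algebraicClasses_projectiveSpace_eq_top`, `subsingleton_complexBetti_projectiveSpace_of_odd`).

No definition, no named-fact hypothesis, no `sorry`.

References: Voisin, *Hodge Theory and Complex Algebraic Geometry I*, §7.3.2, §11.1.2, §11.3.3 Lemma 11.41;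
Grothendieck 1969 §1.
-/

-- `Summit.HodgeConjecture.HodgeConjecture.Theorems` is the mandated namespace (single-conjunct summit),
-- which `linter.dupNamespace` flags; the lakefile turns the linter off tree-wide, restated here so
-- stand-alone elaboration is warning-free too.
set_option linter.dupNamespace false

noncomputable section

open CategoryTheory AlgebraicGeometry MonoidalCategory CartesianMonoidalCategory
open Literature.AlgebraicGeometry Literature.AlgebraicGeometry.Motives
open Literature.AlgebraicGeometry.HodgeTheory Literature.AlgebraicTopology.SingularHomology

namespace Summit.HodgeConjecture.HodgeConjecture.Theorems

namespace CohomologicallyAlgebraic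

/-! ### Invariance under isomorphisms -/

/-- **The cycle part of the Hodge conjecture transports along an isomorphism** `e : X' ≅ X` of smooth
projective `ℂ`-schemes of the same dimension: `(e⁻¹)^* c'` is rational and of type `(p,p)` when `c'`
is (`IsRationalClass.map`, `IsOfHodgeType.map_of_isSmoothProjective`), hence algebraic on `X`, and
`e^*` carries algebraic classes to algebraic classes (`mem_algebraicClasses_map_iff_of_iso`) with
`e^* (e⁻¹)^* c' = c'`. [cite: VoisinHodgeI2002, §7.3.2] [cite: GrothendieckTopology1969, §1] -/
theorem hodgeClasses_algebraic_of_iso {n : ℕ} {X X' : SchemeOver ℂ} (e : X' ≅ X)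
    (hX : IsSmoothProjective n X) (hX' : IsSmoothProjective n X')
    (hHC : ∀ (p : ℕ) (c : complexBetti X (2 * p)), IsRationalClass c → IsOfHodgeType n X (2 * p) p p c →
      c ∈ algebraicClasses X p)
    (p : ℕ) (c' : complexBetti X' (2 * p)) (hc' : IsRationalClass c')
    (hpp : IsOfHodgeType n X' (2 * p) p p c') : c' ∈ algebraicClasses X' p := by
  have h := hHC p (complexBetti.map e.inv (2 * p) c') (hc'.map _)
    (hpp.map_of_isSmoothProjective hX hX' e.inv)
  have h' := (mem_algebraicClasses_map_iff_of_iso e).2 h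
  rwa [e.complexBetti_map_hom_map_inv] at h'

/-- **`HodgeConjectureFor` is invariant under isomorphisms of smooth projective `ℂ`-schemes** (Hodge
models exist on both sides by `nonempty_hodgeModel_holds`). [cite: VoisinHodgeI2002, §7.3.2] -/
theorem hodgeConjectureFor_of_iso {n : ℕ} {X X' : SchemeOver ℂ} (e : X' ≅ X)
    (hX : IsSmoothProjective n X) (hX' : IsSmoothProjective n X') (h : HodgeConjectureFor n X) :
    HodgeConjectureFor n X' :=
  ⟨nonempty_hodgeModel_holds hX', hodgeClasses_algebraic_of_iso e hX hX' h.2⟩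

/-! ### The cohomologically algebraic factor first -/

/-- **`HC(Y) ⟹ HC(V × Y)` for `V` cohomologically algebraic** (the transfer theorem
`hodgeConjectureFor_tensor_of_left` transported along the symmetry `V ⊗ Y ≅ Y ⊗ V`,
`lift snd fst` in both directions). [cite: VoisinHodgeI2002, §11.3.3 Lemma 11.41] -/
theorem hodgeConjectureFor_tensor_of_right {n d : ℕ} {Y V : SchemeOver ℂ}
    (hV : IsSmoothProjective d V) (hY : IsSmoothProjective n Y)
    (hVev : ∀ k : ℕ, algebraicClasses V k = ⊤)
    (hVodd : ∀ k : ℕ, Subsingleton (complexBetti V (2 * k + 1)))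
    (hHC : HodgeConjectureFor n Y) : HodgeConjectureFor (d + n) (V ⊗ Y) := by
  let e : V ⊗ Y ≅ Y ⊗ V :=
    { hom := lift (snd V Y) (fst V Y)
      inv := lift (snd Y V) (fst Y V)
      hom_inv_id := by ext <;> simp
      inv_hom_id := by ext <;> simp }
  have hYV : IsSmoothProjective (d + n) (Y ⊗ V) := Nat.add_comm n d ▸ IsSmoothProjective.tensor_holds hY hV
  have h : HodgeConjectureFor (d + n) (Y ⊗ V) :=
    Nat.add_comm n d ▸ hodgeConjectureFor_tensor_of_left hY hV hVev hVodd hHC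
  exact hodgeConjectureFor_of_iso e hYV (IsSmoothProjective.tensor_holds hV hY) h

/-! ### Stability of the Hodge conjecture under `× ℙᴺ` -/

/-- **`HC(Y) ⟹ HC(Y × ℙᴺ)`** for every smooth projective complex `Y` and every `N` (the transfer
theorem with the cohomologically algebraic factor `ℙᴺ`). [cite: VoisinHodgeI2002, §11.1.2 and §11.3.3] -/
theorem hodgeConjectureFor_tensor_projectiveSpace_of_hodgeConjectureFor {n : ℕ} {Y : SchemeOver ℂ}
    (hY : IsSmoothProjective n Y) (h : HodgeConjectureFor n Y) (N : ℕ) :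
    HodgeConjectureFor (n + N) (Y ⊗ projectiveSpace N ℂ) :=
  hodgeConjectureFor_tensor_of_left hY (isSmoothProjective_projectiveSpace_holds ℂ N)
    (algebraicClasses_projectiveSpace_eq_top N)
    (fun k ↦ subsingleton_complexBetti_projectiveSpace_of_odd N ⟨k, rfl⟩) h

/-- **`HC(Y) ⟹ HC(ℙᴺ × Y)`** for every smooth projective complex `Y` and every `N`.
[cite: VoisinHodgeI2002, §11.1.2 and §11.3.3] -/
theorem hodgeConjectureFor_projectiveSpace_tensor_of_hodgeConjectureFor {n : ℕ} {Y : SchemeOver ℂ}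
    (hY : IsSmoothProjective n Y) (h : HodgeConjectureFor n Y) (N : ℕ) :
    HodgeConjectureFor (N + n) (projectiveSpace N ℂ ⊗ Y) :=
  hodgeConjectureFor_tensor_of_right (isSmoothProjective_projectiveSpace_holds ℂ N) hY
    (algebraicClasses_projectiveSpace_eq_top N)
    (fun k ↦ subsingleton_complexBetti_projectiveSpace_of_odd N ⟨k, rfl⟩) h

/-- **`HC(Y × ℙᴺ)` unconditionally for `dim Y ≤ 3`** (e.g. `(abelian threefold) × ℙᴺ`,
`(Calabi–Yau threefold) × ℙ²` — a fivefold). [cite: VoisinHodgeII2003, §10.2.3 proof of Prop. 10.26]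
[cite: VoisinHodgeI2002, §11.1.2] -/
theorem hodgeConjectureFor_tensor_projectiveSpace_of_dim_le_three {n : ℕ} {Y : SchemeOver ℂ}
    (hn : n ≤ 3) (hY : IsSmoothProjective n Y) (N : ℕ) :
    HodgeConjectureFor (n + N) (Y ⊗ projectiveSpace N ℂ) :=
  hodgeConjectureFor_tensor_projectiveSpace_of_hodgeConjectureFor hY
    (hodgeConjectureFor_of_dim_le_three hodgeClasses_algebraic_of_dim_le_three_holds
      nonempty_hodgeModel_holds hn hY) N

end CohomologicallyAlgebraic

end Summit.HodgeConjecture.HodgeConjecture.Theorems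

end
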